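import Literature.Analysis.FluidPDE.Tao2016AveragedNS.SplitCascadeAsymGronwall
import Literature.Analysis.FluidPDE.Tao2016AveragedNS.SplitCascadeRescaledEnergy
import Literature.Analysis.FluidPDE.TaoCascadeScaleOnePast
import HarnessLib

/-!
# The split Prop. 6.5: the asymmetries of the fresh shell over the whole past (`n₀`-smallness)

T. Tao, *Finite time blowup for an averaged three-dimensional Navier–Stokes equation*,
arXiv:1402.0290v3, §6.4 Lemma 6.7 (summing over the past scales), §6.6 (6.118)/(6.109).
HONEST FRAMING: statements about the SPLIT cascade model system; nothing here proves the split
Prop. 6.5 and nothing here concerns the true Navier–Stokes equations.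

THE ONE NON-MECHANICAL POINT of the split Prop. 6.5 (see `SplitCascadeScaleOneSmall.lean`): the
one-sided bound (6.118)♯/(6.109)♯ on `c̃₁` keeps the integral `∫_{τ₀}^t (1+ε₀)^{5/2}ε²e^{-K¹⁰}Z̃²_{a,1}`
over the WHOLE past of the fresh shell, which must be `n₀`-small; the energy bound `Z̃² ≤ 2Ẽ₁` does
not give that. Here: the POINTWISE past smallness. The asymmetry triple `(Z̃_{a,1}, Z̃_{c,1}, Z̃_{d,1})`
vanishes at `τ₀` ((6.50♯)) and obeys the rotor-neutral energy inequality
(`SplitCascadeAsymEnergy.lean`) with rate `β₁ ≤ c(ε₀,ε,K)(√Ẽ₁ + √Ẽ₂)` and source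
`√3·C₁(1+ε₀)^{2-n₀/2}√Ẽ₁`; over the past both `√Ẽ₁` and `√Ẽ₂` decay geometrically
(`≤ K⁻¹⁵(1+ε₀)^{(499/100)k}` on the `k`-th past interval, from (6.66)), so by Lemma 6.7's summation
`∫_{τ₀}^{τ_k} β₁ ≤ B_past` uniformly in `N` and `∫_{τ₀}^{τ_k} source ≤ 4√3C₁(1+ε₀)^{-n₀/2}K⁻¹⁵C₃G₂₄₈(1+ε₀)^{(248/100)k}`,
whence, by the Euclidean Grönwall (`SplitCascadeAsymGronwall.lean`),
`(Σ_i Z̃_{i,1}(t)²)^{1/2} ≤ e^{B_past}·4√3C₁(1+ε₀)^{-n₀/2}K⁻¹⁵C₃G₂₄₈·(1+ε₀)^{(248/100)k}` on the `k`-th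
past interval — `n₀`-small with geometric decay into the past (`asym_one_past_le`). (The cumulative
`∫Z̃²_{a,1}` and the present window then follow as in `SplitCascadeScaleOneBootstrap.lean`; next file.)

## References

* T. Tao, arXiv:1402.0290v3, §6.4 Lemma 6.7, (6.66); §6.6 (6.118). [`Tao2016AveragedNS`]
* E. Hairer, S. P. Nørsett, G. Wanner, *Solving ODE I*, §I.10. [`HairerNorsettWanner1993`]
-/

noncomputable section

open Set MeasureTheory intervalIntegral

namespace Literature.Analysis.FluidPDE

namespace Tao2016AveragedNS

open TaoCascade
open Literature.Analysis.ODE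

section AsymPast

variable {γ ε₀ K ε C₁ C₂ C₃ : ℝ} {n₀ N : ℤ} {ηp : ℤ → ℝ} {βp : ℕ → ℝ} {τ : ℤ → ℝ}
  {Y : Fin 4 → ℤ → ℝ → ℝ} {W : Fin 3 → ℤ → ℝ → ℝ} {F : ℤ → ℝ → ℝ}

/-- **(6.66) for the shell `2` over the past**: on the `k`-th past interval,
`Ẽ₂ ≤ K⁻³⁰(1+ε₀)^{(499/50)k}`. [cite: Tao2016AveragedNS, §6.4 Prop. 6.5 (6.66)] -/
theorem RescaledSplitHypotheses.energy_two_past_le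
    (h : RescaledSplitHypotheses γ ε₀ K ε C₁ C₂ C₃ n₀ N ηp βp τ Y W F) (hε₀ : 0 < ε₀)
    {k : ℤ} (hk : n₀ - N < k) (hk0 : k ≤ 0) {t : ℝ} (ht : t ∈ Icc (τ (k - 1)) (τ k)) :
    F 2 t ≤ (K ^ 30)⁻¹ * (1 + ε₀) ^ ((499 : ℝ) / 50 * k) := by
  have h0 : (0 : ℝ) < 1 + ε₀ := by linarith
  have h1 : (1 : ℝ) ≤ 1 + ε₀ := by linarith
  obtain ⟨m', hm'⟩ : ∃ m' : ℕ, (m' : ℤ) = 2 - k := ⟨(2 - k).toNat, by omega⟩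
  have hb := h.en_after' k hk hk0 t ht m' (by omega)
  rw [show k + (m' : ℤ) = 2 by omega] at hb
  have hexp : -(10 : ℝ) * m' + (1 - k) / 50 = -(999 : ℝ) / 50 + (499 : ℝ) / 50 * k := by
    have : (m' : ℝ) = 2 - (k : ℝ) := by exact_mod_cast hm'
    rw [this]; ring
  rw [hexp, Real.rpow_add h0] at hb
  have hneg : (1 + ε₀) ^ (-(999 : ℝ) / 50) ≤ 1 :=
    Real.rpow_le_one_of_one_le_of_nonpos h1 (by norm_num)
  have hP : 0 < (1 + ε₀) ^ ((499 : ℝ) / 50 * k) := Real.rpow_pos_of_pos h0 _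
  calc F 2 t ≤ (K ^ 30)⁻¹ * ((1 + ε₀) ^ (-(999 : ℝ) / 50) * (1 + ε₀) ^ ((499 : ℝ) / 50 * k)) := hb
    _ ≤ (K ^ 30)⁻¹ * (1 * (1 + ε₀) ^ ((499 : ℝ) / 50 * k)) := by
        apply mul_le_mul_of_nonneg_left _ (by positivity)
        exact mul_le_mul_of_nonneg_right hneg hP.le
    _ = _ := by ring

/-- `√(K⁻³⁰(1+ε₀)^{(499/50)k}) = K⁻¹⁵(1+ε₀)^{(499/100)k}`, the exponent written as
`(248/100 + 251/100)k` for Lemma 6.7's summation. [cite: Tao2016AveragedNS, §6.4 Lemma 6.7] -/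
theorem sqrt_energy_level_eq {ε₀ K : ℝ} (hε₀ : 0 < ε₀) (hK : 0 < K) (k : ℤ) :
    Real.sqrt ((K ^ 30)⁻¹ * (1 + ε₀) ^ ((499 : ℝ) / 50 * k)) =
      (K ^ 15)⁻¹ * (1 + ε₀) ^ (((248 : ℝ) / 100 + (251 : ℝ) / 100) * k) := by
  have h0 : (0 : ℝ) < 1 + ε₀ := by linarith
  have hsq : (K ^ 30)⁻¹ * (1 + ε₀) ^ ((499 : ℝ) / 50 * k) =
      ((K ^ 15)⁻¹ * (1 + ε₀) ^ (((248 : ℝ) / 100 + (251 : ℝ) / 100) * k)) ^ 2 := by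
    have e1 : ((1 + ε₀) ^ (((248 : ℝ) / 100 + (251 : ℝ) / 100) * k)) ^ 2 =
        (1 + ε₀) ^ ((499 : ℝ) / 50 * k) := by
      rw [← Real.rpow_natCast, ← Real.rpow_mul h0.le]; congr 1; push_cast; ring
    rw [mul_pow, e1]; congr 1; rw [← inv_pow]; ring
  rw [hsq, Real.sqrt_sq (by positivity)]

/-- **The asymmetries of the fresh shell over the past are `n₀`-small** (pointwise, with geometric
decay into the past): for `n₀ - N < k ≤ 0` and `t ∈ [τ_{k-1}, τ_k]`,
`(Σ_i Z̃_{i,1}(t)²)^{1/2} ≤ exp(B_past) · (4√3 C₁ (1+ε₀)^{-n₀/2} K⁻¹⁵ C₃ G₂₄₈) · (1+ε₀)^{(248/100)k}`,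
`B_past = (6(ε + ε² + 2ε⁻² + ε⁻¹K¹⁰) + 36K)·√2·K⁻¹⁵C₃G₂₄₈`, `G₂₄₈ = geomConst ε₀ (248/100)`.
[cite: Tao2016AveragedNS, §6.4 Lemma 6.7; §6.6 (6.118)] -/
theorem RescaledSplitHypotheses.asym_one_past_le
    (h : RescaledSplitHypotheses γ ε₀ K ε C₁ C₂ C₃ n₀ N ηp βp τ Y W F) (hε₀ : 0 < ε₀) (hε₀1 : ε₀ < 1)
    (hK : 1 ≤ K) (hε : 0 < ε) (hC₁ : 0 ≤ C₁) (hC₃ : 0 ≤ C₃)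
    {k : ℤ} (hk : n₀ - N < k) (hk0 : k ≤ 0) {t : ℝ} (ht : t ∈ Icc (τ (k - 1)) (τ k)) :
    Real.sqrt (∑ i, W i 1 t ^ 2) ≤
      Real.exp ((6 * (ε + ε ^ 2 + 2 * (ε ^ 2)⁻¹ + ε⁻¹ * K ^ 10) + 36 * K) * Real.sqrt 2 *
          ((K ^ 15)⁻¹ * C₃ * geomConst ε₀ ((248 : ℝ) / 100))) *
        ((4 * Real.sqrt 3 * C₁ * (1 + ε₀) ^ (-(n₀ : ℝ) / 2)) *
          ((K ^ 15)⁻¹ * C₃ * geomConst ε₀ ((248 : ℝ) / 100)) * (1 + ε₀) ^ ((248 : ℝ) / 100 * k)) := by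
  have h0 : (0 : ℝ) < 1 + ε₀ := by linarith
  have hK0 : 0 < K := by linarith
  set τ₀ := τ (n₀ - N) with hτ₀
  have hτt : τ₀ ≤ t := (h.tau_init_le_tau (by omega) (by omega)).trans ht.1
  have htk : t ≤ τ k := ht.2
  have hτk : τ₀ ≤ τ k := h.tau_init_le_tau (by omega) hk0
  set δ : ℝ := (1 + ε₀) ^ (-(n₀ : ℝ) / 2) with hδ
  have hδ0 : 0 < δ := Real.rpow_pos_of_pos h0 _
  set G : ℝ := (K ^ 15)⁻¹ * C₃ * geomConst ε₀ ((248 : ℝ) / 100) with hG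
  have hG0 : 0 ≤ G := by
    have := geomConst_pos hε₀ (s := (248 : ℝ) / 100) (by norm_num); positivity
  -- constants
  set cβ : ℝ := 6 * (ε + ε ^ 2 + 2 * (ε ^ 2)⁻¹ + ε⁻¹ * K ^ 10) + 36 * K with hcβ
  have hcβ0 : 0 ≤ cβ := by positivity
  have hq6 : (1 + ε₀) ^ ((5 : ℝ) / 2) ≤ 6 := rpow_five_halves_le_six h0.le (by linarith)
  have hq0' : 0 ≤ (1 + ε₀) ^ ((5 : ℝ) / 2) := Real.rpow_nonneg h0.le _
  -- majorants
  set β : ℝ → ℝ := fun s => 6 * (ε + ε ^ 2 + 2 * (ε ^ 2)⁻¹ + ε⁻¹ * K ^ 10) * Real.sqrt (2 * F 1 s) +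
    36 * K * Real.sqrt (2 * F 2 s) with hβ
  set R : ℝ → ℝ := fun s => 4 * Real.sqrt 3 * C₁ * δ * Real.sqrt (F 1 s) with hR
  have hβc : ContinuousOn β (Icc τ₀ (τ k)) :=
    (continuousOn_const.mul ((continuousOn_const.mul (h.continuousOn_E 1 le_rfl)).sqrt)).add
      (continuousOn_const.mul ((continuousOn_const.mul (h.continuousOn_E 2 le_rfl)).sqrt))
  have hRc : ContinuousOn R (Icc τ₀ (τ k)) := continuousOn_const.mul (h.continuousOn_E 1 le_rfl).sqrt
  have hβ0 : ∀ s ∈ Icc τ₀ (τ k), 0 ≤ β s := fun s _ => by simp only [hβ]; positivity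
  have hR0 : ∀ s ∈ Icc τ₀ (τ k), 0 ≤ R s := fun s _ => by simp only [hR]; positivity
  -- the rate is dominated by `β`
  have hrate : ∀ s ∈ Ico τ₀ (τ k), (1 + ε₀) ^ ((5 : ℝ) * (1 : ℤ) / 2) * (ε * |Y 1 1 s| +
      ε ^ 2 * Real.exp (-K ^ 10) * |Y 2 1 s| + (ε ^ 2)⁻¹ * (|Y 0 1 s| + |Y 3 1 s|) +
      ε⁻¹ * K ^ 10 * |Y 1 1 s| + (1 + ε₀) ^ ((5 : ℝ) / 2) * K * |Y 0 (1 + 1) s|) ≤ β s := by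
    intro s hs
    have hs1 : τ (n₀ - N) ≤ s := hs.1
    have hY : ∀ j : Fin 4, |Y j 1 s| ≤ Real.sqrt (2 * F 1 s) := fun j => h.abs_le_sqrt_energy j 1 hs1
    have hY2 : |Y 0 2 s| ≤ Real.sqrt (2 * F 2 s) := h.abs_le_sqrt_energy 0 2 hs1
    have e5 : (1 + ε₀) ^ ((5 : ℝ) * (1 : ℤ) / 2) = (1 + ε₀) ^ ((5 : ℝ) / 2) := by norm_num
    rw [e5, show (1 : ℤ) + 1 = 2 by norm_num]
    set X := Real.sqrt (2 * F 1 s) with hX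
    set X2 := Real.sqrt (2 * F 2 s) with hX2
    have hX0 : 0 ≤ X := Real.sqrt_nonneg _
    have hX20 : 0 ≤ X2 := Real.sqrt_nonneg _
    have hE1 : Real.exp (-K ^ 10) ≤ 1 := Real.exp_le_one_iff.mpr (by
      have : 0 ≤ K ^ 10 := by positivity
      linarith)
    have hin : ε * |Y 1 1 s| + ε ^ 2 * Real.exp (-K ^ 10) * |Y 2 1 s| +
        (ε ^ 2)⁻¹ * (|Y 0 1 s| + |Y 3 1 s|) + ε⁻¹ * K ^ 10 * |Y 1 1 s| +
        (1 + ε₀) ^ ((5 : ℝ) / 2) * K * |Y 0 2 s| ≤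
        (ε + ε ^ 2 + 2 * (ε ^ 2)⁻¹ + ε⁻¹ * K ^ 10) * X + 6 * K * X2 := by
      have a1 : ε * |Y 1 1 s| ≤ ε * X := mul_le_mul_of_nonneg_left (hY 1) hε.le
      have a2 : ε ^ 2 * Real.exp (-K ^ 10) * |Y 2 1 s| ≤ ε ^ 2 * 1 * X :=
        mul_le_mul (mul_le_mul_of_nonneg_left hE1 (sq_nonneg _)) (hY 2) (abs_nonneg _) (by positivity)
      have a3 : (ε ^ 2)⁻¹ * (|Y 0 1 s| + |Y 3 1 s|) ≤ (ε ^ 2)⁻¹ * (X + X) :=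
        mul_le_mul_of_nonneg_left (add_le_add (hY 0) (hY 3)) (by positivity)
      have a4 : ε⁻¹ * K ^ 10 * |Y 1 1 s| ≤ ε⁻¹ * K ^ 10 * X :=
        mul_le_mul_of_nonneg_left (hY 1) (by positivity)
      have a5 : (1 + ε₀) ^ ((5 : ℝ) / 2) * K * |Y 0 2 s| ≤ 6 * K * X2 :=
        mul_le_mul (mul_le_mul_of_nonneg_right hq6 hK0.le) hY2 (abs_nonneg _) (by positivity)
      linarith
    have hin0 : 0 ≤ (ε + ε ^ 2 + 2 * (ε ^ 2)⁻¹ + ε⁻¹ * K ^ 10) * X + 6 * K * X2 := by positivity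
    calc (1 + ε₀) ^ ((5 : ℝ) / 2) * _ ≤ 6 * ((ε + ε ^ 2 + 2 * (ε ^ 2)⁻¹ + ε⁻¹ * K ^ 10) * X +
          6 * K * X2) := mul_le_mul hq6 hin (by positivity) (by norm_num)
      _ = β s := by simp only [hβ, hX, hX2]; ring
  -- the source is dominated by `R`
  have hsrc : ∀ s ∈ Ico τ₀ (τ k),
      Real.sqrt 3 * (C₁ * (1 + ε₀) ^ ((2 : ℝ) * (1 : ℤ) - n₀ / 2) * Real.sqrt (F 1 s)) ≤ R s := by
    intro s _
    have hsplit : (1 + ε₀) ^ ((2 : ℝ) * (1 : ℤ) - n₀ / 2) = (1 + ε₀) ^ (2 : ℝ) * δ := by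
      rw [hδ, ← Real.rpow_add h0]; congr 1; push_cast; ring
    have h4 : (1 + ε₀) ^ (2 : ℝ) ≤ 4 := by
      calc (1 + ε₀) ^ (2 : ℝ) ≤ 2 ^ (2 : ℝ) := Real.rpow_le_rpow h0.le (by linarith) (by norm_num)
        _ = 4 := by norm_num
    rw [hsplit]
    simp only [hR]
    have hs0 : 0 ≤ Real.sqrt (F 1 s) := Real.sqrt_nonneg _
    have : C₁ * ((1 + ε₀) ^ (2 : ℝ) * δ) * Real.sqrt (F 1 s) ≤ C₁ * (4 * δ) * Real.sqrt (F 1 s) := by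
      apply mul_le_mul_of_nonneg_right _ hs0
      exact mul_le_mul_of_nonneg_left (mul_le_mul_of_nonneg_right h4 hδ0.le) hC₁
    have h3 : 0 ≤ Real.sqrt 3 := Real.sqrt_nonneg _
    nlinarith [this, h3]
  -- Grönwall on `[τ₀, τ_k]`
  have hmain := h.sqrt_asym_sq_le (by linarith) hε hK0.le 1 (t₁ := τ₀) (t₂ := τ k) le_rfl
    hβc hβ0 hrate hRc hR0 hsrc ⟨hτt, htk⟩
  -- initial data vanish
  have hinit : Real.sqrt (∑ i, W i 1 τ₀ ^ 2) = 0 := by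
    have : ∑ i, W i 1 τ₀ ^ 2 = 0 := Finset.sum_eq_zero fun i _ => by
      rw [hτ₀, h.init_W i 1 (by omega)]; ring
    rw [this, Real.sqrt_zero]
  rw [hinit, zero_add] at hmain
  -- piecewise levels of `√Ẽ₁`, `√Ẽ₂` on the past intervals
  have hlev : ∀ j, n₀ - N < j → j ≤ 0 → ∀ s ∈ Icc (τ (j - 1)) (τ j), ∀ m : ℤ, (m = 1 ∨ m = 2) →
      Real.sqrt (F m s) ≤ (K ^ 15)⁻¹ * (1 + ε₀) ^ (((248 : ℝ) / 100 + (251 : ℝ) / 100) * j) := by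
    intro j hj hj0 s hs m hm
    rw [← sqrt_energy_level_eq hε₀ hK0 j]
    apply Real.sqrt_le_sqrt
    rcases hm with rfl | rfl
    · exact h.energy_one_past_le hε₀ hj hj0 hs
    · exact h.energy_two_past_le hε₀ hj hj0 hs
  have hs2 : Real.sqrt 2 * Real.sqrt 2 = 2 := Real.mul_self_sqrt (by norm_num)
  have hsq2 : ∀ x : ℝ, Real.sqrt (2 * x) = Real.sqrt 2 * Real.sqrt x := fun x =>
    Real.sqrt_mul (by norm_num) x
  -- `∫ β ≤ B_past`
  have hβint : ∫ s in τ₀..t, β s ≤ cβ * Real.sqrt 2 * G := by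
    have hmono : ∫ s in τ₀..t, β s ≤ ∫ s in τ₀..(τ k), β s := by
      apply integral_mono_interval le_rfl hτt htk
      · exact Filter.Eventually.of_forall fun s => by simp only [hβ]; positivity
      · exact hβc.intervalIntegrable_of_Icc hτk
    have hbound : ∀ j, n₀ - N < j → j ≤ 0 → ∀ s ∈ Icc (τ (j - 1)) (τ j),
        β s ≤ cβ * Real.sqrt 2 * (K ^ 15)⁻¹ * (1 + ε₀) ^ (((248 : ℝ) / 100 + (251 : ℝ) / 100) * j) := by
      intro j hj hj0 s hs
      have l1 := hlev j hj hj0 s hs 1 (Or.inl rfl)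
      have l2 := hlev j hj hj0 s hs 2 (Or.inr rfl)
      simp only [hβ]
      rw [hsq2, hsq2]
      have hL0 : 0 ≤ (K ^ 15)⁻¹ * (1 + ε₀) ^ (((248 : ℝ) / 100 + (251 : ℝ) / 100) * j) := by positivity
      have a1 : 6 * (ε + ε ^ 2 + 2 * (ε ^ 2)⁻¹ + ε⁻¹ * K ^ 10) * (Real.sqrt 2 * Real.sqrt (F 1 s)) ≤
          6 * (ε + ε ^ 2 + 2 * (ε ^ 2)⁻¹ + ε⁻¹ * K ^ 10) * (Real.sqrt 2 *
            ((K ^ 15)⁻¹ * (1 + ε₀) ^ (((248 : ℝ) / 100 + (251 : ℝ) / 100) * j))) :=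
        mul_le_mul_of_nonneg_left (mul_le_mul_of_nonneg_left l1 (Real.sqrt_nonneg _)) (by positivity)
      have a2 : 36 * K * (Real.sqrt 2 * Real.sqrt (F 2 s)) ≤
          36 * K * (Real.sqrt 2 * ((K ^ 15)⁻¹ * (1 + ε₀) ^ (((248 : ℝ) / 100 + (251 : ℝ) / 100) * j))) :=
        mul_le_mul_of_nonneg_left (mul_le_mul_of_nonneg_left l2 (Real.sqrt_nonneg _)) (by positivity)
      calc _ ≤ _ := add_le_add a1 a2
        _ = _ := by simp only [hcβ]; ring
    have hcont0 : ContinuousOn β (Icc (τ (n₀ - N)) 0) :=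
      (continuousOn_const.mul ((continuousOn_const.mul (h.continuousOn_E 1 le_rfl)).sqrt)).add
        (continuousOn_const.mul ((continuousOn_const.mul (h.continuousOn_E 2 le_rfl)).sqrt))
    have hsum := h.integral_past_le hε₀ hC₃ hcont0 (D := cβ * Real.sqrt 2 * (K ^ 15)⁻¹)
      (s := (248 : ℝ) / 100) (by positivity) (by norm_num) hbound (k := k) (by omega) hk0
    have hdec : (1 + ε₀) ^ ((248 : ℝ) / 100 * k) ≤ 1 :=
      Real.rpow_le_one_of_one_le_of_nonpos (by linarith)
        (mul_nonpos_of_nonneg_of_nonpos (by norm_num) (by exact_mod_cast hk0))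
    have hpos : 0 ≤ cβ * Real.sqrt 2 * (K ^ 15)⁻¹ * C₃ * geomConst ε₀ ((248 : ℝ) / 100) := by
      have := geomConst_pos hε₀ (s := (248 : ℝ) / 100) (by norm_num); positivity
    calc ∫ s in τ₀..t, β s ≤ ∫ s in τ₀..(τ k), β s := hmono
      _ ≤ cβ * Real.sqrt 2 * (K ^ 15)⁻¹ * C₃ * geomConst ε₀ ((248 : ℝ) / 100) *
          (1 + ε₀) ^ ((248 : ℝ) / 100 * k) := hsum
      _ ≤ cβ * Real.sqrt 2 * (K ^ 15)⁻¹ * C₃ * geomConst ε₀ ((248 : ℝ) / 100) * 1 :=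
          mul_le_mul_of_nonneg_left hdec hpos
      _ = cβ * Real.sqrt 2 * G := by simp only [hG]; ring
  -- `∫ R ≤ 4√3 C₁ δ G (1+ε₀)^{(248/100) k}`
  have hRint : ∫ s in τ₀..t, R s ≤ 4 * Real.sqrt 3 * C₁ * δ * G * (1 + ε₀) ^ ((248 : ℝ) / 100 * k) := by
    have hmono : ∫ s in τ₀..t, R s ≤ ∫ s in τ₀..(τ k), R s := by
      apply integral_mono_interval le_rfl hτt htk
      · exact Filter.Eventually.of_forall fun s => by simp only [hR]; positivity
      · exact hRc.intervalIntegrable_of_Icc hτk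
    have hbound : ∀ j, n₀ - N < j → j ≤ 0 → ∀ s ∈ Icc (τ (j - 1)) (τ j),
        R s ≤ 4 * Real.sqrt 3 * C₁ * δ * (K ^ 15)⁻¹ *
          (1 + ε₀) ^ (((248 : ℝ) / 100 + (251 : ℝ) / 100) * j) := by
      intro j hj hj0 s hs
      have l1 := hlev j hj hj0 s hs 1 (Or.inl rfl)
      simp only [hR]
      have : 0 ≤ 4 * Real.sqrt 3 * C₁ * δ := by positivity
      calc 4 * Real.sqrt 3 * C₁ * δ * Real.sqrt (F 1 s)
          ≤ 4 * Real.sqrt 3 * C₁ * δ * ((K ^ 15)⁻¹ * (1 + ε₀) ^ (((248 : ℝ) / 100 + (251 : ℝ) / 100) * j)) :=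
            mul_le_mul_of_nonneg_left l1 this
        _ = _ := by ring
    have hcont0 : ContinuousOn R (Icc (τ (n₀ - N)) 0) :=
      continuousOn_const.mul (h.continuousOn_E 1 le_rfl).sqrt
    have hsum := h.integral_past_le hε₀ hC₃ hcont0 (D := 4 * Real.sqrt 3 * C₁ * δ * (K ^ 15)⁻¹)
      (s := (248 : ℝ) / 100) (by positivity) (by norm_num) hbound (k := k) (by omega) hk0
    calc ∫ s in τ₀..t, R s ≤ ∫ s in τ₀..(τ k), R s := hmono
      _ ≤ _ := hsum
      _ = _ := by simp only [hG]; ring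
  -- assemble
  have hE : Real.exp (∫ s in τ₀..t, β s) ≤ Real.exp (cβ * Real.sqrt 2 * G) := Real.exp_le_exp.2 hβint
  have hRint0 : 0 ≤ ∫ s in τ₀..t, R s :=
    integral_nonneg hτt fun s hs => hR0 s ⟨hs.1, hs.2.trans htk⟩
  calc Real.sqrt (∑ i, W i 1 t ^ 2) ≤ Real.exp (∫ s in τ₀..t, β s) * ∫ s in τ₀..t, R s := hmain
    _ ≤ Real.exp (cβ * Real.sqrt 2 * G) * (4 * Real.sqrt 3 * C₁ * δ * G * (1 + ε₀) ^ ((248 : ℝ) / 100 * k)) :=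
        mul_le_mul hE hRint hRint0 (Real.exp_pos _).le
    _ = _ := by simp only [hcβ, hG, hδ]

end AsymPast

end Tao2016AveragedNS

end Literature.Analysis.FluidPDE
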